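import Literature.AlgebraicGeometry.GroupSchemes.BarsottiTateGroupHom            -- ★ `BTGroup`, `BTGroup.Hom`
import Literature.AlgebraicGeometry.GroupSchemes.AffineGroupSchemeOfHopfAlgebra   -- ★ `AffineGroupScheme.Alg.comap` (= `Γ(g)` as a `k`-algebra map)
import Literature.AlgebraicGeometry.GroupSchemes.IsIsoOrEtaleOfNatCard           -- ★ `hom_finrank_eq_finrank_alg`
import Mathlib.RingTheory.Ideal.Pure
import Mathlib.RingTheory.Ideal.Cotangent
import Mathlib.AlgebraicGeometry.Morphisms.Flat
import HarnessLib

/-!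
# The unit component inherits the tangent rank; a one-dimensional Barsotti–Tate group has a connected part of positive height
# ([Tate 1967] §2.2 / (2.4); [Görtz–Wedhorn I] (6.4); [Tate 1997] (3.7))

Topic `Literature/AlgebraicGeometry/GroupSchemes`; namespace `Literature.AlgebraicGeometry.GroupSchemes`.  THEOREMS ONLY; no definition, no named
fact, no instance, no notation, no `sorry`.  Cell `hodgecm-mathlib` (D-0151), P6 «MOD programme», sub-desk F0P6b «ONE-DIMENSIONAL BLOCK NUMERICS»
kit `Cruxes/HLiu418/Lines/F0_P6b_BlockNumerics.lean` ED. 1 (F0P6b-plan (g2), cand 49deda72, CUT OF RECORD 17:07:22Z): organ (n0) FILE C = THE CLOSER of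
`stub_N1c_tangentRankOfUnitComponent` (text reproduced by `BTGroup.pos_height_and_finrank_cotangent_le_of_unitComponent`, one `exact` at ED. 2).
HC_CM is proved only modulo the printed citations until rung 0 closes; nothing here is about HC.

THE PRINT.  [GortzWedhorn2020] (6.4) Def. 6.2 ∕ Prop. 6.7: the Zariski cotangent space `𝔪_x ∕ 𝔪_x²` of a `k`-rational point `x` of an affine
`k`-scheme `X = Spec A` is `I_x ∕ I_x²` for the augmentation ideal `I_x = ker (A → k)`, and it is LOCAL: an open immersion through `x` does not
change it.  For an OPEN-AND-CLOSED immersion `j : X₀ ↪ X` of affine schemes this reads, in global coordinates, `A = A₀ × A₁` with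
`Γ(j) = pr₁`, `I_x = I₀ × A₁`, `I_x² = I₀² × A₁` (`A₁` is unital), so `I_x ∕ I_x² ≅ I₀ ∕ I₀²` — here derived as: `Γ(j)` is SURJECTIVE (closed
immersion into an affine scheme, Mathlib `IsClosedImmersion.isAffine_surjective_of_isAffine`) and FLAT (open immersions are flat; Mathlib
`HasRingHomProperty.iff_of_isAffine` for `Flat`), so its kernel `K` is a PURE ideal, hence idempotent (`K = K²`, Mathlib `Ideal.isIdempotentElem_of_pure`,
[StacksProject, Tag 04PS]), and a surjection with idempotent kernel induces an ISOMORPHISM `I∕I² ⥲ I₀∕I₀²` for `I = Γ(j)⁻¹(I₀)` (§1).  [Tate1967] §2.2 ∕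
(2.4): the connected part `G⁰` of a `p`-divisible group; if `G` is «one-dimensional» (tangent space at the unit of rank `1`) then `G⁰ ≠ 0`, i.e. its
height is positive — a height-`0` Barsotti–Tate group has `G⁰_1 = Spec k`, whose augmentation ideal (hence cotangent space) vanishes.

MAIN STATEMENTS.  §1 `Ideal.mapCotangent_comap_bijective_of_surjective_of_isIdempotentElem_ker`, `Ideal.finrank_cotangent_comap_eq_of_surjective_of_isIdempotentElem_ker`;
§2 `isIdempotentElem_ker_appTop_of_isOpenImmersion_of_surjective` (clopen immersion of affine schemes ⇒ idempotent kernel on global sections);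
§3 `finrank_cotangent_ker_unit_eq_of_unitComponent` (the unit's cotangent rank of `G` equals that of any unit component `G₀ ↪ G`), and the HEAD
**`BTGroup.pos_height_and_finrank_cotangent_le_of_unitComponent`** = the text of `stub_N1c_tangentRankOfUnitComponent`.

## References
* [Tate1967] J. T. Tate, *p-divisible groups*, Proc. Conf. Local Fields (Driebergen, 1966), Springer (1967), §2.2 and (2.4).
* [GortzWedhorn2020] U. Görtz, T. Wedhorn, *Algebraic Geometry I* (2nd ed., 2020), (6.4): Definition 6.2, Proposition 6.7.
* [Tate1997FiniteFlatGroupSchemes] J. Tate, *Finite flat group schemes*, in: Modular Forms and Fermat's Last Theorem (1997), (3.7).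
* [StacksProject] The Stacks Project, Tag 04PS (pure ideals: `R ⧸ I` flat ⇒ `I ∩ J = IJ`, in particular `I = I²`).
-/

set_option autoImplicit false

noncomputable section

universe u v w

open CategoryTheory CategoryTheory.Limits AlgebraicGeometry MonoidalCategory CartesianMonoidalCategory
open scoped MonObj

namespace Literature.AlgebraicGeometry.GroupSchemes

/-! ## §1 Commutative algebra: a surjection with idempotent kernel induces isomorphisms of cotangent modules -/

section Algebra

variable {R : Type u} {A : Type v} {A₀ : Type w} [CommRing R] [CommRing A] [CommRing A₀] [Algebra R A] [Algebra R A₀]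

/-- **A SURJECTIVE algebra map `φ : A ↠ A₀` WITH IDEMPOTENT KERNEL (`K = K²`) induces, for every ideal `J ⊆ A₀` with pull-back `I = φ⁻¹ J`, a
BIJECTION `I ∕ I² ⥲ J ∕ J²`** (Mathlib `Ideal.mapCotangent`): surjective because `φ(I) = J`; injective because `φ a ∈ J² = φ(I²)` gives `a ∈ I² + K` and
`K = K² ⊆ I²`. [cite: StacksProject, Tag 04PS] [cite: GortzWedhorn2020, (6.4) Definition 6.2] -/
theorem Ideal.mapCotangent_comap_bijective_of_surjective_of_isIdempotentElem_ker (φ : A →ₐ[R] A₀) (hφ : Function.Surjective φ)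
    (hK : IsIdempotentElem (RingHom.ker φ.toRingHom)) (J : Ideal A₀) :
    Function.Bijective (Ideal.mapCotangent (J.comap φ) J φ le_rfl) := by
  constructor
  · -- injective
    rw [injective_iff_map_eq_zero]
    intro x hx
    obtain ⟨⟨a, ha⟩, rfl⟩ := (J.comap φ).toCotangent_surjective x
    rw [Ideal.mapCotangent_toCotangent] at hx
    replace hx := (Ideal.toCotangent_eq_zero _ _).mp hx
    refine (Ideal.toCotangent_eq_zero _ _).mpr ?_
    -- `φ a ∈ J² = φ (I²)`
    have hJ : J = Ideal.map φ (J.comap φ) := (Ideal.map_comap_of_surjective φ hφ J).symm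
    have hx' : φ a ∈ Ideal.map φ ((J.comap φ) ^ 2) := by rw [Ideal.map_pow, ← hJ]; exact hx
    obtain ⟨a', ha', haa'⟩ := (Ideal.mem_map_iff_of_surjective φ hφ).mp hx'
    -- `a - a' ∈ K = K² ⊆ I²`
    have hdiff : a - a' ∈ RingHom.ker φ.toRingHom := by
      rw [RingHom.mem_ker]
      change φ (a - a') = 0
      rw [map_sub, haa', sub_self]
    have hKle : RingHom.ker φ.toRingHom ≤ J.comap φ := fun b hb => by
      rw [RingHom.mem_ker] at hb
      change φ b ∈ J
      rw [show φ b = 0 from hb]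
      exact J.zero_mem
    have hK2 : RingHom.ker φ.toRingHom ≤ (J.comap φ) ^ 2 := by
      rw [← hK.eq, pow_two]
      exact Ideal.mul_mono hKle hKle
    have hsum : a = a' + (a - a') := by ring
    change a ∈ (J.comap φ) ^ 2
    rw [hsum]
    exact Ideal.add_mem _ ha' (hK2 hdiff)
  · -- surjective
    intro y
    obtain ⟨⟨b, hb⟩, rfl⟩ := J.toCotangent_surjective y
    obtain ⟨a, rfl⟩ := hφ b
    exact ⟨(J.comap φ).toCotangent ⟨a, hb⟩, by rw [Ideal.mapCotangent_toCotangent]⟩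

/-- … hence **`dim_R I∕I² = dim_R J∕J²`** for `I = φ⁻¹ J`. [cite: GortzWedhorn2020, (6.4) Definition 6.2] [cite: StacksProject, Tag 04PS] -/
theorem Ideal.finrank_cotangent_comap_eq_of_surjective_of_isIdempotentElem_ker (φ : A →ₐ[R] A₀) (hφ : Function.Surjective φ)
    (hK : IsIdempotentElem (RingHom.ker φ.toRingHom)) (J : Ideal A₀) :
    Module.finrank R (J.comap φ).Cotangent = Module.finrank R J.Cotangent :=
  (LinearEquiv.ofBijective _ (Ideal.mapCotangent_comap_bijective_of_surjective_of_isIdempotentElem_ker φ hφ hK J)).finrank_eq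

end Algebra

/-! ## §2 An open-and-closed immersion of affine schemes has an idempotent kernel on global sections -/

section Clopen

/-- **`Γ(j)` of an OPEN immersion `j : X₀ → X` of affine schemes which is SURJECTIVE on global sections (e.g. `j` also a closed immersion) has an
IDEMPOTENT kernel `K = K²`**: `Γ(j)` is flat (open immersions are flat; `Flat` is a ring-hom property on affines), so `Γ(X) ⧸ K ≅ Γ(X₀)` is a flat
`Γ(X)`-module, i.e. `K` is PURE, hence idempotent. [cite: StacksProject, Tag 04PS] [cite: GortzWedhorn2020, (6.4) Proposition 6.7] -/
theorem isIdempotentElem_ker_appTop_of_isOpenImmersion_of_surjective {X₀ X : Scheme.{u}} (j : X₀ ⟶ X) [IsAffine X₀] [IsAffine X]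
    [IsOpenImmersion j] (hsurj : Function.Surjective j.appTop.hom) :
    IsIdempotentElem (RingHom.ker j.appTop.hom) := by
  have hflat : j.appTop.hom.Flat := (HasRingHomProperty.iff_of_isAffine (P := @Flat)).mp inferInstance
  letI : Algebra Γ(X, ⊤) Γ(X₀, ⊤) := j.appTop.hom.toAlgebra
  haveI : Module.Flat Γ(X, ⊤) Γ(X₀, ⊤) := hflat
  -- `Γ(X) ⧸ K ≅ Γ(X₀)` linearly over `Γ(X)`
  have hsurj' : Function.Surjective (Algebra.ofId Γ(X, ⊤) Γ(X₀, ⊤)) := hsurj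
  let e := Ideal.quotientKerAlgEquivOfSurjective hsurj'
  have hker : RingHom.ker (Algebra.ofId Γ(X, ⊤) Γ(X₀, ⊤)).toRingHom = RingHom.ker j.appTop.hom := rfl
  haveI : (RingHom.ker (Algebra.ofId Γ(X, ⊤) Γ(X₀, ⊤)).toRingHom).Pure := Module.Flat.of_linearEquiv e.toLinearEquiv
  rw [← hker]
  exact Ideal.isIdempotentElem_of_pure _

end Clopen

/-! ## §3 The unit component inherits the tangent rank; positive height of the connected part -/

section UnitComponent

variable {k : Type u} [Field k]

open AffineGroupScheme

/-- **THE COTANGENT RANK AT THE UNIT IS THAT OF ANY UNIT COMPONENT.**  For a homomorphism `j : G₀ ↪ G` of affine group objects over `Spec k` whose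
underlying morphism is an OPEN-AND-CLOSED immersion, the augmentation ideals `I = ker Γ(η_G)` and `I₀ = ker Γ(η_{G₀})` have cotangent modules of the
same `k`-dimension: `η_G = η_{G₀} ≫ j`, so `I = Γ(j)⁻¹ I₀`, and §1–§2 apply. [cite: GortzWedhorn2020, (6.4) Definition 6.2 and Proposition 6.7]
[cite: Tate1997FiniteFlatGroupSchemes, (3.7)] -/
theorem finrank_cotangent_ker_unit_eq_of_unitComponent (G G₀ : Over (Spec (.of k))) [GrpObj G] [GrpObj G₀] [IsAffine G.left] [IsAffine G₀.left]
    (j : G₀ ⟶ G) [IsMonHom j] [IsOpenImmersion j.left] [IsClosedImmersion j.left] :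
    Module.finrank k (RingHom.ker ((η[G] : 𝟙_ (Over (Spec (.of k))) ⟶ G).left.appTop.hom) : Ideal (Alg G)).Cotangent =
      Module.finrank k (RingHom.ker ((η[G₀] : 𝟙_ (Over (Spec (.of k))) ⟶ G₀).left.appTop.hom) : Ideal (Alg G₀)).Cotangent := by
  -- `Γ(j)` as a `k`-algebra map, surjective with idempotent kernel
  have hsurj : Function.Surjective (Alg.comap j) := (IsClosedImmersion.isAffine_surjective_of_isAffine j.left).2
  have hK : IsIdempotentElem (RingHom.ker (Alg.comap j).toRingHom) :=
    isIdempotentElem_ker_appTop_of_isOpenImmersion_of_surjective j.left hsurj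
  -- `η_G = η_{G₀} ≫ j`, so the augmentation ideal of `G` is the pull-back of that of `G₀`
  have hη : (η[G] : 𝟙_ (Over (Spec (.of k))) ⟶ G).left.appTop.hom =
      ((η[G₀] : 𝟙_ (Over (Spec (.of k))) ⟶ G₀).left.appTop.hom).comp (Alg.comap j).toRingHom := by
    have h1 : (η[G] : 𝟙_ (Over (Spec (.of k))) ⟶ G) = η[G₀] ≫ j := (IsMonHom.one_hom (f := j)).symm
    rw [h1, Over.comp_left, Scheme.Hom.comp_appTop, CommRingCat.hom_comp]
    rfl
  have hI : (RingHom.ker ((η[G] : 𝟙_ (Over (Spec (.of k))) ⟶ G).left.appTop.hom) : Ideal (Alg G)) =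
      (RingHom.ker ((η[G₀] : 𝟙_ (Over (Spec (.of k))) ⟶ G₀).left.appTop.hom) : Ideal (Alg G₀)).comap (Alg.comap j) := by
    ext x
    rw [RingHom.mem_ker, hη, Ideal.mem_comap, RingHom.mem_ker]
    rfl
  rw [hI]
  exact Ideal.finrank_cotangent_comap_eq_of_surjective_of_isIdempotentElem_ker (Alg.comap j) hsurj hK _

/-- **THE HEAD — the text of `stub_N1c_tangentRankOfUnitComponent` (P6b «BLOCK NUMERICS» ED. 1).**  Let `ι₀ : B₀ → B` be a homomorphism of
Barsotti–Tate groups over a field `k` whose layers are OPEN-AND-CLOSED immersions with CONNECTED source (the unit components), and suppose the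
augmentation ideal of every layer `B.G n` has cotangent module of `k`-dimension `≤ 1` («`B` is at most one-dimensional») and that of `B.G 1` is
non-zero.  THEN `0 < H₀` (if `H₀ = 0` then `Γ(B₀.G 1) = k`, its augmentation ideal is `0`, and by `finrank_cotangent_ker_unit_eq_of_unitComponent` so is the
cotangent module of `B.G 1` — contradiction), and every layer of `B₀` carries an augmentation `ε₀ : Γ(B₀.G n) →ₐ[k] k` (its unit, read through
`Γ(Spec k) ≅ k`) of cotangent rank `≤ 1` — the input of the ★ PRODUCER `BTGroup.isConnectedDimOne_of_finrank_cotangent_le_one`.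
[cite: Tate1967, §2.2 and (2.4)] [cite: GortzWedhorn2020, (6.4)] [cite: Tate1997FiniteFlatGroupSchemes, (3.7)] -/
theorem BTGroup.pos_height_and_finrank_cotangent_le_of_unitComponent (p : ℕ) {H H₀ : ℕ} (B : BTGroup (Spec (.of k)) p H)
    (B₀ : BTGroup (Spec (.of k)) p H₀) (ι₀ : BTGroup.Hom B₀ B)
    (hι₀ : ∀ n, IsOpenImmersion (ι₀.app n).left ∧ IsClosedImmersion (ι₀.app n).left ∧ ConnectedSpace ↥(B₀.G n).left)
    (htan : ∀ n, letI := B.grpObj n;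
      Module.finrank k (RingHom.ker ((η[B.G n] : 𝟙_ (Over (Spec (.of k))) ⟶ B.G n).left.appTop.hom) : Ideal (Alg (B.G n))).Cotangent ≤ 1)
    (hdim : letI := B.grpObj 1;
      Module.finrank k (RingHom.ker ((η[B.G 1] : 𝟙_ (Over (Spec (.of k))) ⟶ B.G 1).left.appTop.hom) : Ideal (Alg (B.G 1))).Cotangent ≠ 0) :
    0 < H₀ ∧ ∀ n, ∃ ε₀ : Alg (B₀.G n) →ₐ[k] k, Module.finrank k (RingHom.ker ε₀.toRingHom).Cotangent ≤ 1 := by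
  -- per layer: the unit of `B₀.G n` as an augmentation `ε₀`, with kernel the augmentation ideal and cotangent rank that of `B.G n`
  have key : ∀ n, ∃ ε₀ : Alg (B₀.G n) →ₐ[k] k,
      (RingHom.ker ε₀.toRingHom = letI := B₀.grpObj n;
        (RingHom.ker ((η[B₀.G n] : 𝟙_ (Over (Spec (.of k))) ⟶ B₀.G n).left.appTop.hom) : Ideal (Alg (B₀.G n)))) ∧
      Module.finrank k (RingHom.ker ε₀.toRingHom).Cotangent =
        letI := B.grpObj n;
        Module.finrank k (RingHom.ker ((η[B.G n] : 𝟙_ (Over (Spec (.of k))) ⟶ B.G n).left.appTop.hom) : Ideal (Alg (B.G n))).Cotangent := by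
    intro n
    letI := B.grpObj n
    letI := B₀.grpObj n
    haveI := ι₀.isMonHom_app n
    obtain ⟨hjo, hjc, -⟩ := hι₀ n
    haveI : IsFinite (B.G n).hom := B.isFinite n
    haveI : IsFinite (B₀.G n).hom := B₀.isFinite n
    haveI : IsAffine (B.G n).left := isAffine_left_of_isAffineHom (B.G n)
    haveI : IsAffine (B₀.G n).left := isAffine_left_of_isAffineHom (B₀.G n)
    -- the unit of `B₀.G n` read through `Γ(Spec k) ≅ k`
    set ηl : (Spec (.of k) : Scheme.{u}) ⟶ (B₀.G n).left := ((η[B₀.G n] : 𝟙_ (Over (Spec (.of k))) ⟶ B₀.G n).left) with hηl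
    let e₀ : Alg (B₀.G n) →+* k := (Scheme.ΓSpecIso (.of k)).hom.hom.comp ηl.appTop.hom
    have hsec : ηl ≫ (B₀.G n).hom = 𝟙 _ := Over.w _
    have hring : ((Scheme.ΓSpecIso (.of k)).inv ≫ (B₀.G n).hom.appTop) ≫ (ηl.appTop ≫ (Scheme.ΓSpecIso (.of k)).hom) = 𝟙 _ := by
      rw [Category.assoc, ← Category.assoc ((B₀.G n).hom.appTop), ← Scheme.Hom.comp_appTop, hsec, Scheme.Hom.id_appTop,
        Category.id_comp, Iso.inv_hom_id]
    have hcomm : ∀ r : k, e₀ (algebraMap k (Alg (B₀.G n)) r) = r := fun r => by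
      have h := congrArg (fun φ => φ.hom r) hring
      simp only [CommRingCat.hom_comp, RingHom.coe_comp, Function.comp_apply, CommRingCat.hom_id, RingHom.id_apply] at h
      change (Scheme.ΓSpecIso (.of k)).hom.hom (ηl.appTop.hom (((Scheme.ΓSpecIso (.of k)).inv ≫ (B₀.G n).hom.appTop).hom r)) = r
      exact h
    let ε₀ : Alg (B₀.G n) →ₐ[k] k := { toRingHom := e₀, commutes' := hcomm }
    have hker : RingHom.ker ε₀.toRingHom = (RingHom.ker ηl.appTop.hom : Ideal (Alg (B₀.G n))) :=
      RingHom.ker_comp_of_injective _ (Scheme.ΓSpecIso (.of k)).commRingCatIsoToRingEquiv.injective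
    refine ⟨ε₀, hker, ?_⟩
    rw [hker]
    exact (finrank_cotangent_ker_unit_eq_of_unitComponent (B.G n) (B₀.G n) (ι₀.app n)).symm
  refine ⟨?_, fun n => ?_⟩
  · -- `0 < H₀`: at height `0` the layer `B₀.G 1` has rank `1`, so its augmentation is injective and the cotangent module vanishes
    by_contra h0
    have hH₀ : H₀ = 0 := Nat.eq_zero_of_not_pos h0
    obtain ⟨ε₀, -, hε₀⟩ := key 1
    apply hdim
    rw [← hε₀]
    letI := B₀.grpObj 1
    haveI : IsFinite (B₀.G 1).hom := B₀.isFinite 1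
    haveI : IsAffine (B₀.G 1).left := isAffine_left_of_isAffineHom (B₀.G 1)
    -- `dim_k Γ(B₀.G 1) = p^(1·0) = 1`
    have hrk : Module.finrank k (Alg (B₀.G 1)) = 1 := by
      rw [← hom_finrank_eq_finrank_alg (B₀.G 1) (IsLocalRing.closedPoint k : PrimeSpectrum k), B₀.finrank_eq 1, hH₀, mul_zero, pow_zero]
    haveI : Module.Finite k (Alg (B₀.G 1)) := Module.finite_of_finrank_eq_succ hrk
    -- the augmentation is surjective (`ε₀ 1 = 1`), so its kernel has dimension `1 − 1 = 0`
    have hsurjε : Function.Surjective ε₀.toLinearMap := fun r => ⟨algebraMap k _ r, ε₀.commutes r⟩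
    have hdimker : Module.finrank k (LinearMap.ker ε₀.toLinearMap) = 0 := by
      have h := LinearMap.finrank_range_add_finrank_ker ε₀.toLinearMap
      rw [LinearMap.range_eq_top.mpr hsurjε, finrank_top, Module.finrank_self, hrk] at h
      omega
    have hbot : RingHom.ker ε₀.toRingHom = ⊥ := by
      have h1 : (LinearMap.ker ε₀.toLinearMap) = ⊥ := Submodule.finrank_eq_zero.mp hdimker
      ext a
      simp only [RingHom.mem_ker, AlgHom.toRingHom_eq_coe, AlgHom.coe_toRingHom, Ideal.mem_bot]
      constructor
      · intro ha
        have : a ∈ LinearMap.ker ε₀.toLinearMap := ha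
        rw [h1] at this
        exact this
      · intro ha; rw [ha, map_zero]
    rw [hbot]
    haveI : Subsingleton (⊥ : Ideal (Alg (B₀.G 1))).Cotangent :=
      (Ideal.cotangent_subsingleton_iff _).mpr (by rw [IsIdempotentElem, Ideal.bot_mul])
    exact Module.finrank_zero_of_subsingleton
  · obtain ⟨ε₀, -, hε₀⟩ := key n
    exact ⟨ε₀, hε₀ ▸ htan n⟩

end UnitComponent

end Literature.AlgebraicGeometry.GroupSchemes

end
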